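import Summits.CriticalPhenomena.PercolationContinuityZ3.Theorems.PercNearOneGluingNoHeavyLowerTailSunflowerChainGame
import Summits.CriticalPhenomena.PercolationContinuityZ3.Theorems.PercNearOneGluingNoHeavyLowerTailSunflowerCoverP4
import HarnessLib

/-!
# `NoHeavyLowerTail` (crux stmt-CriticalPhenomena-4575), abstract sunflower cubic: STAIRCASE CNF CORES (CHAIN-GRAPH CORES) HAVE
# THE COVER PROPERTY — hence they are GRADEDLY SAFE, SAFE, and their disjunction with any safe core on a disjoint block is SAFE

Support file (seat `prim-ineq-prove-1` gen 44; `--supports stmt-CriticalPhenomena-4575`).  No `sorry`, no named facts.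
Memo: run/shared/lean/prim/prim-ineq-prove-1/FINDING-CHAINCOVER-prove1-g44.md §2.

SETTING.  A STAIRCASE CNF: clauses `C_k = P k ∪ Q k` (`k : Fin N`) with `P` ANTITONE, `Q` MONOTONE and the `P`-block
`L = ⋃ P k` disjoint from the `Q`-block `Rb = ⋃ Q k`; the core is `clauseCore (stair P Q) = ⋀_k (Hit(P k) ∨ Hit(Q k))`.  These are
exactly the edge-cores of CHAIN GRAPHS (bipartite graphs with nested neighbourhoods on one side = `2K₂`-free bipartite graphs =
difference graphs; twin-free ones are the half graphs `H_m : l_i ~ r_j ⟺ j ≤ i`, `C_k = {l_i : i ≥ k} ∪ {r_j : j < k}`), containing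
every complete bipartite core (`N = 2`, `P = (L, ∅)`, `Q = (∅, Rb)`) and the path core `P₄ = H_2`.
* `cover_of_weights` — the COVER property (`…SunflowerCoverGraded`) from a balanced-weight certificate
  `famIn 𝒰 ≤ ∏_{C ∈ 𝒯 ∖ 𝒰} t C`, `∏_{C ∈ 𝒯} t C ≤ famIn ∅`, `t ∈ [0,1]` (the certificate of `…SunflowerBalancedWeights`, which derived
  only the partition test from it): each member lies outside at least `K − m` of `K` families of multiplicity `≤ m`.
* **`famIn_stair_eq`** — conditioning on the two blocks (`BEx_union`): with `X(T₁) = #{k : P k ⊄ T₁}` (the hit `P`-clauses form the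
  prefix `{k < X}` because `P` is antitone) and `Y(T₂) = #{k : Q k ⊆ T₂}` (the missed `Q`-clauses form the prefix `{k < Y}`), the clause
  `C_k` is hit iff `k < X ∨ Y ≤ k`, so `famIn (stair P Q) 𝒰 = ChainGame.G x F R_𝒰` — the CHAIN GAME of `…SunflowerChainGame` with
  `x i = P(X = i)`, `F κ = P(Y ≤ κ)` (`F ⊤ = 1`) and `R_𝒰 = {k : C_k ∉ 𝒰}`.
The consequences (`cover_stair`, `gsafe_stair`, `safe_stair`, `safe_stair_union`) are drawn in `…SunflowerChainCoverSafe` (≤ 400 lines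
per file); the graph form (chain graphs in rank form, `Γ_chain ⊔ Γ₀`) is `…SunflowerChainGraph`.
-/

noncomputable section

namespace Summit.CriticalPhenomena.PercolationContinuityZ3.Theorems.SunflowerPartition

namespace SafeCalc

open MeasureTheory Finset
open Literature.Probability.LatticeModels Literature.Probability.Percolation
open TwoGenCore (wmiss)

variable {ι : Type*} [DecidableEq ι] (p : ι → unitInterval) (a : Finset ι)

/-! ## The cover property from a balanced-weight certificate -/

/-- A member of multiplicity `≤ m` among `K` families lies outside at least `K − m` of them, so the product over the families
AVOIDING it of a weight `t ∈ [0,1]` is at most `t^(K−m)`. [this work] -/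
theorem prod_ite_notMem_le_pow_of_card {K : ℕ} (𝒰 : Fin K → Finset (Finset ι)) (m : ℕ) (C : Finset ι)
    (hC : (univ.filter fun k => C ∈ 𝒰 k).card ≤ m) {t : ℝ} (ht0 : 0 ≤ t) (ht1 : t ≤ 1) :
    ∏ k, (if C ∉ 𝒰 k then t else 1) ≤ t ^ (K - m) := by
  classical
  rw [← prod_filter, prod_const]
  have hc : (univ.filter fun k => C ∉ 𝒰 k).card = K - (univ.filter fun k => C ∈ 𝒰 k).card := by
    have := Finset.card_filter_add_card_filter_not (s := (univ : Finset (Fin K))) (fun k => C ∈ 𝒰 k)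
    rw [card_univ, Fintype.card_fin] at this
    omega
  rw [hc]
  exact pow_le_pow_of_le_one ht0 ht1 (by omega)

/-- **COVER from a balanced-weight certificate.**  If weights `t C ∈ [0,1]` (`C ∈ 𝒯`) satisfy
`famIn p a 𝒯 𝒰 ≤ ∏_{C ∈ 𝒯 ∖ 𝒰} t C` for every `𝒰 ⊆ 𝒯` and `∏_{C ∈ 𝒯} t C ≤ famIn p a 𝒯 ∅` (a point of the core of the cost
game `−log famIn`), then `𝒯` has the cover property. [this work] -/
theorem cover_of_weights (𝒯 : Finset (Finset ι)) (t : Finset ι → ℝ) (ht0 : ∀ C ∈ 𝒯, 0 ≤ t C)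
    (ht1 : ∀ C ∈ 𝒯, t C ≤ 1) (hprod : ∏ C ∈ 𝒯, t C ≤ famIn p a 𝒯 ∅)
    (hR : ∀ 𝒰, 𝒰 ⊆ 𝒯 → famIn p a 𝒯 𝒰 ≤ ∏ C ∈ 𝒯 \ 𝒰, t C) : Cover p a 𝒯 := by
  classical
  intro K m S hS
  have hfam : ∀ k, famIn p a 𝒯 (S k) = famIn p a 𝒯 (S k ∩ 𝒯) := fun k =>
    famIn_congr p a 𝒯 fun C hC => by rw [mem_inter]; exact ⟨fun h => ⟨h, hC⟩, fun h => h.1⟩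
  have hsd : ∀ k, ∏ C ∈ 𝒯 \ (S k ∩ 𝒯), t C = ∏ C ∈ 𝒯, (if C ∉ S k then t C else 1) := fun k => by
    rw [sdiff_eq_filter, prod_filter]
    refine prod_congr rfl fun C hC => ?_
    have : (C ∉ S k ∩ 𝒯) ↔ C ∉ S k := by rw [mem_inter]; exact ⟨fun h hk => h ⟨hk, hC⟩, fun h hk => h hk.1⟩
    by_cases h : C ∈ S k
    · rw [if_neg (fun hn => this.1 hn h), if_neg (not_not.2 h)]
    · rw [if_pos (this.2 h), if_pos h]
  calc ∏ k, famIn p a 𝒯 (S k) = ∏ k, famIn p a 𝒯 (S k ∩ 𝒯) := prod_congr rfl fun k _ => hfam k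
    _ ≤ ∏ k, ∏ C ∈ 𝒯 \ (S k ∩ 𝒯), t C :=
        prod_le_prod (fun k _ => famIn_nonneg p a 𝒯 _) fun k _ => hR _ inter_subset_right
    _ = ∏ k, ∏ C ∈ 𝒯, (if C ∉ S k then t C else 1) := prod_congr rfl fun k _ => hsd k
    _ = ∏ C ∈ 𝒯, ∏ k, (if C ∉ S k then t C else 1) := prod_comm
    _ ≤ ∏ C ∈ 𝒯, t C ^ (K - m) := by
        refine prod_le_prod (fun C hC => prod_nonneg fun k _ => ?_) fun C hC =>
          prod_ite_notMem_le_pow_of_card S m C (hS C hC) (ht0 C hC) (ht1 C hC)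
        split_ifs
        · exact zero_le_one
        · exact ht0 C hC
    _ = (∏ C ∈ 𝒯, t C) ^ (K - m) := prod_pow 𝒯 (K - m) t
    _ ≤ famIn p a 𝒯 ∅ ^ (K - m) := pow_le_pow_left₀ (prod_nonneg fun C hC => ht0 C hC) hprod _

/-- Congruence for block expectations. [this work] -/
theorem BEx_congr' (a : Finset ι) {F G : Finset ι → ℝ} (h : ∀ T, T ⊆ a → F T = G T) : BEx p a F = BEx p a G :=
  sum_congr rfl fun T hT => by rw [h T (mem_powerset.1 hT)]

/-! ## Staircase CNFs -/

section Stair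

variable {N : ℕ} (P Q : Fin N → Finset ι)

/-- The clauses `C_k = P k ∪ Q k` of a staircase CNF. [this work] -/
def stairClause (k : Fin N) : Finset ι := P k ∪ Q k

/-- The clause family `{P k ∪ Q k : k}` of a staircase CNF. [this work] -/
def stair : Finset (Finset ι) := univ.image (stairClause P Q)

/-- The `P`-block `⋃_k P k`. [this work] -/
def blockP : Finset ι := univ.biUnion P

/-- The `Q`-block `⋃_k Q k`. [this work] -/
def blockQ : Finset ι := univ.biUnion Q

/-- **Staircase hypotheses**: `P` antitone, `Q` monotone, and the two blocks disjoint. [this work] -/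
structure IsStair (P Q : Fin N → Finset ι) : Prop where
  /-- `P` is antitone. -/
  anti : ∀ ⦃j k : Fin N⦄, j ≤ k → P k ⊆ P j
  /-- `Q` is monotone. -/
  mono : ∀ ⦃j k : Fin N⦄, j ≤ k → Q j ⊆ Q k
  /-- The `P`-block and the `Q`-block are disjoint. -/
  disj : Disjoint (blockP P) (blockQ Q)

/-- Every clause lies in the union of the two blocks. [this work] -/
theorem stairClause_subset (k : Fin N) : stairClause P Q k ⊆ blockP P ∪ blockQ Q :=
  union_subset_union (subset_biUnion_of_mem P (mem_univ k)) (subset_biUnion_of_mem Q (mem_univ k))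

/-- Every member of `stair P Q` lies in the union of the two blocks. [this work] -/
theorem subset_of_mem_stair {C : Finset ι} (hC : C ∈ stair P Q) : C ⊆ blockP P ∪ blockQ Q := by
  obtain ⟨k, _, rfl⟩ := mem_image.1 hC
  exact stairClause_subset P Q k

/-- The support of the clause family is the union of the two blocks. [this work] -/
theorem biUnion_stair : (stair P Q).biUnion id = blockP P ∪ blockQ Q := by
  ext e
  rw [mem_biUnion, mem_union, blockP, blockQ, mem_biUnion, mem_biUnion]
  constructor
  · rintro ⟨C, hC, he⟩
    obtain ⟨k, _, rfl⟩ := mem_image.1 hC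
    rcases mem_union.1 he with h | h
    · exact Or.inl ⟨k, mem_univ _, h⟩
    · exact Or.inr ⟨k, mem_univ _, h⟩
  · rintro (⟨k, _, hk⟩ | ⟨k, _, hk⟩)
    · exact ⟨_, mem_image_of_mem _ (mem_univ k), mem_union.2 (Or.inl hk)⟩
    · exact ⟨_, mem_image_of_mem _ (mem_univ k), mem_union.2 (Or.inr hk)⟩

/-! ### The two counters -/

/-- A lower subset of `Fin N` is the prefix of its own length. [this work] -/
theorem mem_iff_lt_card_of_isLower {H : Finset (Fin N)} (hH : ∀ ⦃j k : Fin N⦄, j ≤ k → k ∈ H → j ∈ H)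
    (k : Fin N) : k ∈ H ↔ (k : ℕ) < H.card := by
  constructor
  · intro hk
    have h1 : Iic k ⊆ H := fun j hj => hH (mem_Iic.1 hj) hk
    have h2 := card_le_card h1
    rw [Fin.card_Iic] at h2
    omega
  · intro hlt
    by_contra hk
    have h1 : H ⊆ Iio k := fun j hj => mem_Iio.2 (lt_of_not_ge fun hkj => hk (hH hkj hj))
    have h2 := card_le_card h1
    rw [Fin.card_Iio] at h2
    omega

/-- `X(T)`: the number of `P`-clauses NOT entirely inside the missing set `T` (the hit ones). [this work] -/
def cntX (T : Finset ι) : ℕ := (univ.filter fun k => ¬ P k ⊆ T).card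

/-- `Y(T)`: the number of `Q`-clauses entirely inside the missing set `T` (the missed ones). [this work] -/
def cntY (T : Finset ι) : ℕ := (univ.filter fun k => Q k ⊆ T).card

/-- `X(T) ≤ N`. [this work] -/
theorem cntX_le (T : Finset ι) : cntX P T ≤ N :=
  (card_le_univ _).trans (by rw [Fintype.card_fin])

/-- The position of the walker `X`, as an element of `Fin (N+1)`. [this work] -/
def posX (T : Finset ι) : Fin (N + 1) := ⟨cntX P T, Nat.lt_succ_of_le (cntX_le P T)⟩

variable {P Q}

/-- For antitone `P` the hit `P`-clauses form the prefix `{k < X(T)}`. [this work] -/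
theorem not_subset_iff_lt_cntX (hP : ∀ ⦃j k : Fin N⦄, j ≤ k → P k ⊆ P j) (T : Finset ι) (k : Fin N) :
    ¬ P k ⊆ T ↔ (k : ℕ) < cntX P T := by
  have h := mem_iff_lt_card_of_isLower (H := univ.filter fun k => ¬ P k ⊆ T)
    (fun j k hjk hk => by
      rw [mem_filter] at hk ⊢
      exact ⟨mem_univ _, fun hj => hk.2 ((hP hjk).trans hj)⟩) k
  rw [mem_filter] at h
  exact ⟨fun hk => h.1 ⟨mem_univ _, hk⟩, fun hk => (h.2 hk).2⟩

/-- For monotone `Q` the missed `Q`-clauses form the prefix `{k < Y(T)}`. [this work] -/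
theorem subset_iff_lt_cntY (hQ : ∀ ⦃j k : Fin N⦄, j ≤ k → Q j ⊆ Q k) (T : Finset ι) (k : Fin N) :
    Q k ⊆ T ↔ (k : ℕ) < cntY Q T := by
  have h := mem_iff_lt_card_of_isLower (H := univ.filter fun k => Q k ⊆ T)
    (fun j k hjk hk => by
      rw [mem_filter] at hk ⊢
      exact ⟨mem_univ _, (hQ hjk).trans hk.2⟩) k
  rw [mem_filter] at h
  exact ⟨fun hk => h.1 ⟨mem_univ _, hk⟩, fun hk => (h.2 hk).2⟩

/-! ### The chain game of a staircase CNF -/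

/-- `Y ≤ κ` for a point-or-top `κ` (`⊤`: always). [this work] -/
def okW (y : ℕ) (κ : WithTop (Fin N)) : Prop := ∀ k : Fin N, κ = (k : WithTop (Fin N)) → y ≤ (k : ℕ)

/-- `okW` is decidable (it is a bounded quantifier over `Fin N`). [this work] -/
instance okW.instDecidable (y : ℕ) (κ : WithTop (Fin N)) : Decidable (okW y κ) := by
  unfold okW; infer_instance

/-- `okW y` is monotone in the point. [this work] -/
theorem okW_mono (y : ℕ) {κ κ' : WithTop (Fin N)} (h : κ ≤ κ') (hκ : okW y κ) : okW y κ' := by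
  intro k' hk'
  rw [hk'] at h
  induction κ with
  | top => exact absurd h (WithTop.not_top_le_coe k')
  | coe k =>
      have hk := hκ k rfl
      rw [WithTop.coe_le_coe, Fin.le_iff_val_le_val] at h
      omega

/-- `okW y ⊤` holds. [this work] -/
theorem okW_top (y : ℕ) : okW (N := N) y ⊤ := fun _ hk => absurd hk WithTop.top_ne_coe

/-- "Every point of `R` at or above position `i` is at least `y`" is `okW y (next R i)`. [this work] -/
theorem forall_mem_iff_okW_next (R : Finset (Fin N)) (i : Fin (N + 1)) (y : ℕ) :
    (∀ k ∈ R, (i : ℕ) ≤ (k : ℕ) → y ≤ (k : ℕ)) ↔ okW y (ChainGame.next R i) := by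
  constructor
  · intro h k' hk'
    have hm : k' ∈ R.filter fun k : Fin N => (i : ℕ) ≤ (k : ℕ) := Finset.mem_of_min hk'
    rw [mem_filter] at hm
    exact h k' hm.1 hm.2
  · intro h k hk hik
    have hle := ChainGame.next_le_of_mem hk hik
    induction hκ : ChainGame.next R i with
    | top => rw [hκ] at hle; exact absurd hle (WithTop.not_top_le_coe k)
    | coe k' =>
        have h1 := h k' hκ
        rw [hκ, WithTop.coe_le_coe, Fin.le_iff_val_le_val] at hle
        omega

/-- The law of the walker `X`: `x i = P(X = i)` as a block expectation over the `P`-block. [this work] -/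
def lawX (P : Fin N → Finset ι) (i : Fin (N + 1)) : ℝ :=
  ∑ T ∈ (blockP P).powerset with posX P T = i, wmiss p (blockP P) T

/-- The distribution function of the walker `Y`: `F κ = P(Y ≤ κ)` (`F ⊤ = 1`) over the `Q`-block. [this work] -/
def cdfY (Q : Fin N → Finset ι) (κ : WithTop (Fin N)) : ℝ :=
  BEx p (blockQ Q) fun T => if okW (cntY Q T) κ then 1 else 0

/-- The avoid-set `R_𝒰 = {k : C_k ∉ 𝒰}` of an allowed family. [this work] -/
def avoid (P Q : Fin N → Finset ι) (𝒰 : Finset (Finset ι)) : Finset (Fin N) :=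
  univ.filter fun k => stairClause P Q k ∉ 𝒰

/-- The law of `X` is nonnegative. [this work] -/
theorem lawX_nonneg (i : Fin (N + 1)) : 0 ≤ lawX p P i :=
  sum_nonneg fun T _ => wmiss_nonneg p _ T

/-- The law of `X` has total mass one. [this work] -/
theorem sum_lawX : ∑ i, lawX p P i = 1 := by
  unfold lawX
  rw [sum_fiberwise_of_maps_to (g := posX P) (fun T _ => mem_univ _)]
  exact sum_wmiss p (blockP P)

/-- `cdfY` is nonnegative. [this work] -/
theorem cdfY_nonneg (κ : WithTop (Fin N)) : 0 ≤ cdfY p Q κ :=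
  BEx_nonneg p _ fun T _ => by split_ifs <;> norm_num

/-- `cdfY` is monotone. [this work] -/
theorem cdfY_mono : Monotone (cdfY p Q) := fun κ κ' h =>
  BEx_mono p _ fun T _ => by
    by_cases h1 : okW (cntY Q T) κ
    · rw [if_pos h1, if_pos (okW_mono _ h h1)]
    · rw [if_neg h1]; split_ifs <;> norm_num

/-- `cdfY ⊤ = 1`. [this work] -/
theorem cdfY_top : cdfY p Q ⊤ = 1 := by
  unfold cdfY
  rw [BEx_congr' p (blockQ Q) (G := fun _ => (1 : ℝ)) fun T _ => if_pos (okW_top _), BEx_const]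

/-- The chain game of the staircase at the empty set is `1`. [this work] -/
theorem G_lawX_cdfY_empty : ChainGame.G (lawX p P) (cdfY p Q) ∅ = 1 := by
  unfold ChainGame.G
  have h : ∀ i : Fin (N + 1), ChainGame.next (∅ : Finset (Fin N)) i = ⊤ := fun i =>
    ChainGame.next_eq_top fun k hk => absurd hk (notMem_empty k)
  simp only [h, cdfY_top, mul_one]
  exact sum_lawX p

/-- On a missing set `T₁ ∪ T₂` split along the blocks, a `P`-clause is missed iff it is missed by `T₁`. [this work] -/
theorem P_subset_union_iff (hS : IsStair P Q) {T₁ T₂ : Finset ι} (h₂ : T₂ ⊆ blockQ Q) (k : Fin N) :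
    P k ⊆ T₁ ∪ T₂ ↔ P k ⊆ T₁ := by
  refine ⟨fun h e he => ?_, fun h => h.trans subset_union_left⟩
  rcases mem_union.1 (h he) with h1 | h1
  · exact h1
  · exact absurd (h₂ h1) (Finset.disjoint_left.1 hS.disj (mem_biUnion.2 ⟨k, mem_univ _, he⟩))

/-- On a missing set `T₁ ∪ T₂` split along the blocks, a `Q`-clause is missed iff it is missed by `T₂`. [this work] -/
theorem Q_subset_union_iff (hS : IsStair P Q) {T₁ T₂ : Finset ι} (h₁ : T₁ ⊆ blockP P) (k : Fin N) :
    Q k ⊆ T₁ ∪ T₂ ↔ Q k ⊆ T₂ := by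
  refine ⟨fun h e he => ?_, fun h => h.trans subset_union_right⟩
  rcases mem_union.1 (h he) with h1 | h1
  · exact absurd (h₁ h1) (Finset.disjoint_right.1 hS.disj (mem_biUnion.2 ⟨k, mem_univ _, he⟩))
  · exact h1

/-- **The hit pattern of a staircase**: with the missing set split along the blocks, every clause of `R` is hit iff
`Y(T₂) ≤ next R (X(T₁))`. [this work] -/
theorem forall_hit_iff (hS : IsStair P Q) (R : Finset (Fin N)) {T₁ T₂ : Finset ι} (h₁ : T₁ ⊆ blockP P)
    (h₂ : T₂ ⊆ blockQ Q) :
    (∀ k ∈ R, ¬ stairClause P Q k ⊆ T₁ ∪ T₂) ↔ okW (cntY Q T₂) (ChainGame.next R (posX P T₁)) := by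
  rw [← forall_mem_iff_okW_next]
  refine forall₂_congr fun k _ => ?_
  rw [stairClause, union_subset_iff, P_subset_union_iff hS h₂, Q_subset_union_iff hS h₁, not_and_or,
    not_subset_iff_lt_cntX hS.anti, subset_iff_lt_cntY hS.mono]
  change (k : ℕ) < cntX P T₁ ∨ ¬ (k : ℕ) < cntY Q T₂ ↔ (cntX P T₁ ≤ (k : ℕ) → cntY Q T₂ ≤ (k : ℕ))
  omega

/-- **THE CHAIN GAME OF A STAIRCASE CNF.**  For every allowed family `𝒰`,
`famIn p (L ∪ Rb) (stair P Q) 𝒰 = ChainGame.G (lawX p P) (cdfY p Q) (avoid P Q 𝒰)`. [this work] -/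
theorem famIn_stair_eq (hS : IsStair P Q) (𝒰 : Finset (Finset ι)) :
    famIn p (blockP P ∪ blockQ Q) (stair P Q) 𝒰 = ChainGame.G (lawX p P) (cdfY p Q) (avoid P Q 𝒰) := by
  classical
  set R := avoid P Q 𝒰 with hR
  -- the indicator of `famIn` is the indicator "every clause of `R` is hit"
  have hind : ∀ T : Finset ι, (∀ C ∈ stair P Q, C ⊆ T → C ∈ 𝒰) ↔ ∀ k ∈ R, ¬ stairClause P Q k ⊆ T := by
    intro T
    simp only [stair, mem_image, mem_univ, true_and, forall_exists_index, forall_apply_eq_imp_iff, hR, avoid,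
      mem_filter]
    exact ⟨fun h k hk hkT => hk (h k hkT), fun h k hkT => by_contra fun hk => h k hk hkT⟩
  unfold famIn
  rw [BEx_congr' p _ (G := fun T => if ∀ k ∈ R, ¬ stairClause P Q k ⊆ T then (1 : ℝ) else 0)
    (fun T _ => by rw [if_congr (hind T) rfl rfl]), BEx_union p hS.disj]
  -- inner block expectation = `cdfY (next R (posX T₁))`
  rw [BEx_congr' p (blockP P) (G := fun T₁ => cdfY p Q (ChainGame.next R (posX P T₁))) (fun T₁ h₁ => by
    unfold cdfY
    exact BEx_congr' p _ fun T₂ h₂ => by rw [if_congr (forall_hit_iff hS R h₁ h₂) rfl rfl])]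
  -- outer block expectation, summed fibrewise over the value of `X`
  unfold BEx ChainGame.G lawX
  rw [← sum_fiberwise_of_maps_to (g := posX P) (t := univ) (fun T _ => mem_univ _)]
  refine sum_congr rfl fun i _ => ?_
  rw [sum_mul]
  refine sum_congr rfl fun T hT => ?_
  obtain ⟨-, hTi⟩ := mem_filter.1 hT
  dsimp only
  rw [hTi]

/-- In particular `famIn ∅ = G univ` (the probability of the core). [this work] -/
theorem famIn_stair_empty (hS : IsStair P Q) :
    famIn p (blockP P ∪ blockQ Q) (stair P Q) ∅ = ChainGame.G (lawX p P) (cdfY p Q) univ := by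
  rw [famIn_stair_eq p hS ∅]
  congr 1
  ext k
  simp [avoid]

end Stair

end SafeCalc

end Summit.CriticalPhenomena.PercolationContinuityZ3.Theorems.SunflowerPartition
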